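import Mathlib
import HarnessLib
import Summits.NavierStokesRegularity.FluidComputer.TriggeredTransferAmplifierValve
import Summits.NavierStokesRegularity.FluidComputer.TriggeredTransferEulerInstance

/-!
# Door N1-FC split: the VALVE predicate is inhabited non-vacuously at zero viscosity — and degenerates there

Cell `ns-blowup`, seat `ns-blowup-fc-prover-1` g4 (D-0074 GROUP C «bridge support»; LADDER-NS rung N1-FC).
Companion of `TriggeredTransferAmplifierValve.lean` (the planner's typing `KickAlphabet` / `Amplifies`
/ `Valve` of shape (α′)) and of `TriggeredTransferEulerInstance.lean` (g3: the Gavrilov alphabet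
`SteadyBlob.scheme` — `λ = 2`, `η = 1`, `U⋆ = 1`, `F U = {U • G}`, `C_τ = 4`, `q = 0` — and the
`ν = 0`, `ε = 1` degeneracy of `TriggerScheme.Step`). LABEL: E–C typing / CALIBRATION. WHAT THIS IS
NOT: not Navier–Stokes evidence — a PRESCRIBED STATIC Euler flow (`ν = 0`): the kicked states are
chosen to BE the zoomed children, so the «valve» moves nothing; nothing about `Valve` or `Amplifies`
at any `ν > 0`, and NOT an amplifier at `ν = 0` either (a trigger of amplitude `ε ↓ 0` cannot move an
O(1) blob in bounded time — the wall recorded by g3).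

* `SteadyBlob.kick B : B.scheme.KickAlphabet` — kicked states at amplitude `U`: the `λ = 2` zooms
  `zoom 2 x₀ (U' • G)`, `U' ≥ √2 U`, `‖x₀‖ ≤ 4r` (Clay data by `clay_zoom`; speed `2U' ‖G x⋆‖ ≥ U ‖G x⋆‖`
  at `x₀ + x⋆/2 ∈ B̄(0, 5r)`); `kick_nonempty` (every level `U ≥ 1` has kicked states);
* `SteadyBlob.valve_inviscid : B.scheme.Valve B.kick 0` — from a kicked state the CONSTANT flow
  (a zoomed steady Euler pair, `steady_zoom` + `isClassicalNSSolutionOn_steady`) is an unforced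
  classical finite-energy bounded solution on `[0, 2/U + 1/(2U)]` whose slice at `T₂ = 2/U = (C_τ/2)/U`
  is (still) the zoomed member `U' • G ∈ F U'` one amplitude level up;
* `exists_valve_inviscid_nonempty_kick` — headline: SOME scheme with a kicked alphabet inhabited at
  every level has a valve at `ν = 0`.

Reading (junk map, complements `valve_empty` of the Probes file): `Valve` alone is satisfiable not
only vacuously (empty alphabet) but also STATICALLY whenever the kicked states are steady zoomed
letters of the unforced dynamics — available at `ν = 0` by Gavrilov's blobs; the content of shape (α′)
is the CONJUNCTION with `Amplifies` on the same alphabet at `ν > 0`, which no file of the tree inhabits.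

References: A. V. Gavrilov, *A steady Euler flow with compact support*, GAFA 29 (2019) [cite: Gavrilov2019, §1 Theorem];
T. Tao, J. Amer. Math. Soc. 29 (2016) §1.3 [cite: Tao2016AveragedNS, §1.3]. 0 sorry; axioms ⊆ {propext,
Classical.choice, Quot.sound}.
-/

noncomputable section

namespace Summit.NavierStokesRegularity.FluidComputer.TriggeredTransfer

open Set MeasureTheory Function Metric
open scoped ENNReal ContDiff NNReal
open Literature.Analysis.FluidPDE
open Literature.Analysis.FluidPDE.FluidComputer (E3 Vel)

namespace SteadyBlob

variable (B : SteadyBlob)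

/-! ## The kicked alphabet of zoomed children -/

/-- The letter of the Gavrilov alphabet at amplitude `U'`: `x ↦ U' • G x`. [folklore] -/
def letter (U' : ℝ) : Vel := fun x => U' • B.G x

/-- The letter at amplitude `U'` is THE member of `F U'`. [folklore] -/
theorem letter_mem (U' : ℝ) : B.letter U' ∈ B.scheme.F U' := rfl

/-- The letters are Clay data (amplitudes `U' ≥ 1`). [folklore] -/
theorem clay_letter {U' : ℝ} (hU' : 1 ≤ U') :
    ContDiff ℝ ∞ (B.letter U') ∧ NSWave0.IsDivFree (B.letter U') ∧ HasRapidSpatialDecay (B.letter U') :=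
  B.scheme.clay U' hU' _ (B.letter_mem U')

/-- The letters have finite energy. [folklore] -/
theorem lintegral_letter_lt_top {U' : ℝ} (hU' : 1 ≤ U') : ∫⁻ x, ‖B.letter U' x‖ₑ ^ 2 < ⊤ := by
  obtain ⟨hsm, -, hdec⟩ := B.clay_letter hU'
  have hH := hdec.lintegral_enorm_iteratedFDeriv_sq_lt_top (μ := volume) 0
  refine lt_of_le_of_lt (le_of_eq (lintegral_congr fun x => ?_)) hH
  rw [← ofReal_norm, ← ofReal_norm, norm_iteratedFDeriv_zero]

/-- **The kicked alphabet of zoomed children** for the Gavrilov alphabet: at amplitude `U` the kicked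
states are the `λ = 2` zooms `zoom 2 x₀ (U' • G)` of letters one amplitude level up (`U' ≥ √2 U`)
centred within the displacement bound (`‖x₀‖ ≤ 4r`). Clay data (`clay_zoom`); speed floor
`‖G x⋆‖ · U ≤ 2U' ‖G x⋆‖` read at `x₀ + x⋆/2`, inside `B̄(0, 5r)`. A junk design: the kicked states ARE
the children. [folklore] -/
def kick : B.scheme.KickAlphabet where
  K U := {v | ∃ (U' : ℝ) (x₀ : E3), Real.sqrt 2 * U ≤ U' ∧ ‖x₀‖ ≤ 4 * B.r ∧ v = zoom 2 x₀ (B.letter U')}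
  clay U hU v hv := by
    obtain ⟨U', x₀, hU', -, rfl⟩ := hv
    have hU1 : (1 : ℝ) ≤ U := hU
    have hU'1 : 1 ≤ U' := by nlinarith [Real.one_lt_sqrt_two]
    exact clay_zoom (B.clay_letter hU'1) two_pos x₀
  floor U hU v hv := by
    obtain ⟨U', x₀, hU', hx₀, rfl⟩ := hv
    have hU1 : (1 : ℝ) ≤ U := hU
    have hU'0 : 0 ≤ U' := by nlinarith [Real.one_lt_sqrt_two]
    refine ⟨x₀ + (1 / 2 : ℝ) • B.xStar, ?_, ?_⟩
    · show ‖x₀ + (1 / 2 : ℝ) • B.xStar‖ ≤ 5 * B.r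
      calc ‖x₀ + (1 / 2 : ℝ) • B.xStar‖ ≤ ‖x₀‖ + ‖(1 / 2 : ℝ) • B.xStar‖ := norm_add_le _ _
        _ ≤ 4 * B.r + 1 / 2 * B.r := by
            rw [norm_smul, Real.norm_of_nonneg (by norm_num : (0 : ℝ) ≤ 1 / 2)]
            exact add_le_add hx₀ (mul_le_mul_of_nonneg_left B.norm_xStar_lt.le (by norm_num))
        _ ≤ 5 * B.r := by linarith [B.r_pos]
    · show ‖B.G B.xStar‖ * U ≤ ‖zoom 2 x₀ (B.letter U') (x₀ + (1 / 2 : ℝ) • B.xStar)‖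
      have harg : (2 : ℝ) • (x₀ + (1 / 2 : ℝ) • B.xStar - x₀) = B.xStar := by
        rw [add_sub_cancel_left, smul_smul]; norm_num
      rw [zoom_apply, harg, letter, norm_smul, norm_smul, Real.norm_of_nonneg zero_le_two,
        Real.norm_of_nonneg hU'0]
      have hG : 0 ≤ ‖B.G B.xStar‖ := norm_nonneg _
      have hU0 : 0 ≤ U := by linarith
      have h1 : U ≤ U' := by
        refine le_trans ?_ hU'
        have := mul_le_mul_of_nonneg_right Real.one_lt_sqrt_two.le hU0
        rwa [one_mul] at this
      have h2 : ‖B.G B.xStar‖ * U ≤ ‖B.G B.xStar‖ * U' := mul_le_mul_of_nonneg_left h1 hG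
      nlinarith [mul_nonneg hU'0 hG]

/-- Membership in the kicked alphabet, unfolded. [folklore] -/
theorem mem_kick_iff {U : ℝ} {v : Vel} : v ∈ B.kick.K U ↔
    ∃ (U' : ℝ) (x₀ : E3), Real.sqrt 2 * U ≤ U' ∧ ‖x₀‖ ≤ 4 * B.r ∧ v = zoom 2 x₀ (B.letter U') :=
  Iff.rfl

/-- Every level has kicked states (e.g. the centred child `zoom 2 0 (√2 U • G)`). [folklore] -/
theorem kick_nonempty (U : ℝ) : (B.kick.K U).Nonempty :=
  ⟨zoom 2 0 (B.letter (Real.sqrt 2 * U)), (B.mem_kick_iff).2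
    ⟨Real.sqrt 2 * U, 0, le_rfl, by rw [norm_zero]; linarith [B.r_pos], rfl⟩⟩

/-! ## The static valve -/

/-- The zoomed letter is a steady Euler pair with the zoomed pressure (`steady_zoom` with amplitude
`2U'`, ratio `2`). [folklore] -/
theorem steady_zoom_letter {U' : ℝ} (hU' : 0 < U') (x₀ : E3) :
    VectorCalculus.IsDivFree (zoom 2 x₀ (B.letter U')) ∧
      ∀ x, convect (zoom 2 x₀ (B.letter U')) (zoom 2 x₀ (B.letter U')) x +
        gradient (fun y => (2 * U') ^ 2 • B.P ((2 : ℝ) • (y - x₀))) x = 0 := by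
  have h := steady_zoom B.smooth_G B.smooth_P B.divFree B.euler (mul_pos two_pos hU') two_pos x₀
  have hz : zoom 2 x₀ (B.letter U') = fun x => (2 * U') • B.G ((2 : ℝ) • (x - x₀)) := by
    funext x
    rw [zoom_apply, letter, smul_smul]
  rw [hz]
  exact h

/-- **THE VALVE IS INHABITED AT ZERO VISCOSITY (statically).** For the Gavrilov alphabet with the
kicked alphabet of zoomed children, `Valve` holds at `ν = 0`: from `v = zoom 2 x₀ (U' • G)`,
`U' ≥ √2 U`, `‖x₀‖ ≤ 4r`, take `T₂ = 2/U = (C_τ/2)/U`, margin `1/(2U)`, and the CONSTANT flow `u t = v`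
with the zoomed pressure — an unforced classical Euler solution (steady pair), finite energy
(`lintegral_enorm_sq_zoom`), bounded (`2U' sup ‖G‖`), `u 0 = v`, and `u T₂ = v = λ-zoom of the letter
U' • G ∈ F U'` with `growth · U = √2 U ≤ U'`. The valve does NOTHING: calibration of the typing, not a
mechanism. [folklore] -/
theorem valve_inviscid : B.scheme.Valve B.kick 0 := by
  intro U hU v hv
  obtain ⟨U', x₀, hU', hx₀, rfl⟩ := hv
  have hU1 : (1 : ℝ) ≤ U := hU
  have hU0 : 0 < U := by linarith
  have hU'1 : 1 ≤ U' := by nlinarith [Real.one_lt_sqrt_two]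
  have hU'0 : 0 < U' := by linarith
  obtain ⟨hdiv, hE⟩ := B.steady_zoom_letter hU'0 x₀
  have hsmW : ContDiff ℝ ∞ (zoom 2 x₀ (B.letter U')) := (clay_zoom (B.clay_letter hU'1) two_pos x₀).1
  have hsmQ : ContDiff ℝ ∞ (fun y => (2 * U') ^ 2 • B.P ((2 : ℝ) • (y - x₀))) :=
    (B.smooth_P.comp ((contDiff_id.sub contDiff_const).const_smul (2 : ℝ))).const_smul _
  obtain ⟨M, hM0, hM⟩ := B.exists_bound_G
  refine ⟨2 / U, 1 / (2 * U), fun _ => zoom 2 x₀ (B.letter U'),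
    fun _ => fun y => (2 * U') ^ 2 • B.P ((2 : ℝ) • (y - x₀)), by positivity, ?_, ?_,
    isClassicalNSSolutionOn_steady _ hsmW hsmQ hdiv hE, rfl, ?_, ?_, U', B.letter U', x₀, ?_,
    B.letter_mem U', hx₀, ?_⟩
  · -- `2 δ < T₂`
    rw [show 2 * (1 / (2 * U)) = 1 / U by field_simp]
    exact div_lt_div_of_pos_right (by norm_num) hU0
  · -- the Re-uniform law `T₂ ≤ (C_τ/2)/U`, `C_τ = 4`
    show 2 / U ≤ 4 / 2 / U
    norm_num
  · -- finite energy (constant in time)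
    refine ⟨∫⁻ x, ‖zoom 2 x₀ (B.letter U') x‖ₑ ^ 2, ?_, fun t _ => le_rfl⟩
    rw [lintegral_enorm_sq_zoom two_pos]
    exact ENNReal.mul_lt_top (ENNReal.mul_lt_top ENNReal.ofReal_lt_top ENNReal.ofReal_lt_top)
      (B.lintegral_letter_lt_top hU'1)
  · -- sup-ceiling
    refine ⟨2 * (U' * M), fun t _ x => ?_⟩
    show ‖zoom 2 x₀ (B.letter U') x‖ ≤ 2 * (U' * M)
    rw [zoom_apply, letter, norm_smul, norm_smul, Real.norm_of_nonneg zero_le_two,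
      Real.norm_of_nonneg hU'0.le]
    exact mul_le_mul_of_nonneg_left (mul_le_mul_of_nonneg_left (hM _) hU'0.le) zero_le_two
  · -- amplitude bookkeeping `growth · U ≤ U'`
    rw [growth_scheme]
    exact hU'
  · -- the hand-over slice IS the zoomed letter
    funext x
    rfl

/-- **Headline**: some scheme with a kicked alphabet INHABITED at every level `U ≥ U⋆` has a valve at
zero viscosity (the static Gavrilov design). Together with `valve_empty` / `not_amplifies_empty`
(Probes file): `Valve` alone is cheap twice over — vacuously and statically; no file of the tree
inhabits `Amplifies ∧ Valve` on one alphabet. [folklore] -/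
theorem exists_valve_inviscid_nonempty_kick :
    ∃ (𝒮 : TriggerScheme) (𝒦 : 𝒮.KickAlphabet), (∀ U, 𝒮.UStar ≤ U → (𝒦.K U).Nonempty) ∧ 𝒮.Valve 𝒦 0 := by
  obtain ⟨B⟩ := SteadyBlob.nonempty
  exact ⟨B.scheme, B.kick, fun U _ => B.kick_nonempty U, B.valve_inviscid⟩

end SteadyBlob

end Summit.NavierStokesRegularity.FluidComputer.TriggeredTransfer

end
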